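import Literature.NumberTheory.Automorphic.ModularFormAlgebraicLambda
import HarnessLib

/-!
# `M_{2k}(Γ(2))` is spanned by the monomials `θ₂^{4a} θ₃^{4b}`, `a + b = k`

Cohn–Kumar–Miller–Radchenko–Viazovska, *Universal optimality of the `E₈` and Leech lattices and
interpolation formulas*, Ann. of Math. 196 (2022), arXiv:1902.05438, §2.1.2: with `U = θ₀₀⁴`,
`V = θ₁₀⁴`, `W = θ₀₁⁴` (weight-`2` modular forms for `Γ(2)`, `U = V + W`), "`𝓜(Γ(2))` is the
polynomial ring generated by `V` and `W`". We PROVE the spanning half in every even weight: every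
`f ∈ M_{2k}(Γ(2))` is a homogeneous polynomial of degree `k` in `U = θ₃⁴` and `V = θ₂⁴`
(equivalently in `V, W`), so `dim M_{2k}(Γ(2)) ≤ k + 1`
(`exists_eq_sum_theta_pow_mul_theta_pow`, `finrank_modularForm_Gamma_two_le`).

Proof. By `exists_polynomial_modularForm_Gamma_two` (`ModularFormAlgebraicLambda.lean`, from the
Laurent-polynomial theorem for the Hauptmodul `λ`), `(f/Uᵏ) λᵏ(1−λ)ᵏ = P(λ)` with `deg P ≤ 3k`.
Holomorphy of `f` at the cusp `∞` (where `λ → 0` and `f/Uᵏ` stays bounded) forces `Xᵏ ∣ P`: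
`|P(x)| ≤ C|x|ᵏ` on a punctured neighbourhood of `0`, which is covered by values `λ(τ)`, `Im τ`
large, because `q ↦ λ/16` is open at the nome `q = 0` (`ModularLambdaNome.lean`); holomorphy at
the cusp `0` (`λ(−1/τ) = 1 − λ(τ) → 1`) forces `(1−X)ᵏ ∣ P` likewise. Hence
`P = Xᵏ(1−X)ᵏ Q`, `deg Q ≤ k`, `f/Uᵏ = Q(λ)` and `f = Uᵏ Q(V/U) = Σ_{j ≤ k} q_j Vʲ U^{k−j}`.

* `X_pow_dvd_of_norm_eval_le` — a polynomial with `|P(x)| ≤ C|x|ᵏ` near `0` is divisible by `Xᵏ`;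
* `exists_forall_exists_modularLambda_eq` — every `x ≠ 0` small enough is `λ(τ)` with `Im τ ≥ B`;
* `exists_norm_modularForm_div_le`, `exists_norm_modularForm_div_S_smul_le` — `f/Uᵏ` is bounded at
  the cusps `∞` and `0`;
* **`exists_polynomial_modularForm_Gamma_two_eq_eval`** — `f/Uᵏ = Q(λ)`, `deg Q ≤ k`;
* **`exists_eq_sum_theta_pow_mul_theta_pow`** — `f = Σ_{j ≤ k} q_j θ₂^{4j} θ₃^{4(k−j)}`;
* **`finrank_modularForm_Gamma_two_le`** — `dim M_{2k}(Γ(2)) ≤ k + 1`;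
* `thetaV_slash_eq_of_mem_Gamma_two`, `monomial_slash` — `V` and the monomials `Vʲ U^{k−j}` are
  modular forms for `Γ(2)`; **`finrank_modularForm_Gamma_two`** — `dim M_{2k}(Γ(2)) = k + 1`
  (the monomials are a basis).

## References

* H. Cohn, A. Kumar, S. D. Miller, D. Radchenko, M. Viazovska, Ann. of Math. 196 (2022) 983–1082,
  arXiv:1902.05438, §2.1.2 ("`𝓜(Γ(2))` is the polynomial ring generated by `V` and `W`").
  [CohnEtAl2019]
* [CalegariDimitrovTang2025] F. Calegari, V. Dimitrov, Y. Tang, J. Amer. Math. Soc. 38 (2025),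
  arXiv:2109.09040, §4.2 (`Y(2) = Spec ℂ[λ, 1/λ, 1/(1−λ)]`, the Hauptmodul `λ`).
-/

noncomputable section

open Complex Filter Topology Function Set Polynomial Metric
open UpperHalfPlane hiding I
open scoped Real Topology MatrixGroups ModularForm Manifold

namespace Literature.NumberTheory.Automorphic

namespace ModularLambda

open Literature.NumberTheory.EllipticCurves.JacobiThetaNull
open Literature.NumberTheory.ModularForms (thetaU thetaV thetaW thetaU_apply thetaV_apply
  thetaU_slash_S thetaU_slash_T thetaV_slash_S thetaV_slash_T thetaW_slash_S thetaW_slash_T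
  tendsto_thetaU)
open ModularGroup Matrix.SpecialLinearGroup

/-! ### Polynomials small near `0` are divisible by `Xᵏ` -/

/-- **A polynomial with `|P(x)| ≤ C|x|ᵏ` on a punctured neighbourhood of `0` is divisible by
`Xᵏ`.** [folklore] -/
theorem X_pow_dvd_of_norm_eval_le {P : ℂ[X]} {k : ℕ} {C r : ℝ} (hr : 0 < r)
    (h : ∀ x : ℂ, x ≠ 0 → ‖x‖ < r → ‖P.eval x‖ ≤ C * ‖x‖ ^ k) : X ^ k ∣ P := by
  induction k generalizing P C with
  | zero => exact ⟨P, by rw [pow_zero, one_mul]⟩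
  | succ k ih =>
    -- `P(0) = 0`
    have hC : 0 ≤ C := by
      have hx : ((r / 2 : ℝ) : ℂ) ≠ 0 := by
        exact_mod_cast (div_pos hr two_pos).ne'
      have := h ((r / 2 : ℝ) : ℂ) hx (by
        rw [Complex.norm_real, Real.norm_eq_abs, abs_of_pos (div_pos hr two_pos)]
        linarith)
      have hpos : 0 < ‖((r / 2 : ℝ) : ℂ)‖ ^ (k + 1) := pow_pos (norm_pos_iff.mpr hx) _
      nlinarith [norm_nonneg (P.eval ((r / 2 : ℝ) : ℂ))]
    have h0 : P.eval 0 = 0 := by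
      have htend : Tendsto (fun x : ℂ ↦ ‖P.eval x‖) (𝓝[≠] 0) (𝓝 ‖P.eval 0‖) :=
        ((P.continuous.tendsto 0).norm).mono_left nhdsWithin_le_nhds
      have hbound : Tendsto (fun x : ℂ ↦ C * ‖x‖ ^ (k + 1)) (𝓝[≠] (0 : ℂ)) (𝓝 0) := by
        have : Tendsto (fun x : ℂ ↦ C * ‖x‖ ^ (k + 1)) (𝓝 (0 : ℂ)) (𝓝 (C * ‖(0 : ℂ)‖ ^ (k + 1))) :=
          ((continuous_norm.pow _).const_mul C).tendsto 0
        rw [norm_zero, zero_pow (Nat.succ_ne_zero k), mul_zero] at this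
        exact this.mono_left nhdsWithin_le_nhds
      have hev : ∀ᶠ x in 𝓝[≠] (0 : ℂ), ‖P.eval x‖ ≤ C * ‖x‖ ^ (k + 1) := by
        have hball : {(0 : ℂ)}ᶜ ∩ ball (0 : ℂ) r ∈ 𝓝[≠] (0 : ℂ) :=
          inter_mem_nhdsWithin _ (ball_mem_nhds 0 hr)
        filter_upwards [hball] with x hx
        exact h x hx.1 (by simpa using hx.2)
      have hle := le_of_tendsto_of_tendsto htend hbound hev
      exact norm_le_zero_iff.mp hle
    -- `P = X Q` and `Q` satisfies the hypothesis with `k`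
    obtain ⟨Q, hQ⟩ : X ∣ P := by
      rw [X_dvd_iff, coeff_zero_eq_eval_zero]
      exact h0
    have hQ' : ∀ x : ℂ, x ≠ 0 → ‖x‖ < r → ‖Q.eval x‖ ≤ C * ‖x‖ ^ k := by
      intro x hx hxr
      have := h x hx hxr
      rw [hQ, eval_mul, eval_X, norm_mul] at this
      have h2 : ‖x‖ * ‖Q.eval x‖ ≤ ‖x‖ * (C * ‖x‖ ^ k) := by
        calc _ ≤ C * ‖x‖ ^ (k + 1) := this
          _ = ‖x‖ * (C * ‖x‖ ^ k) := by ring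
      exact le_of_mul_le_mul_left h2 (norm_pos_iff.mpr hx)
    obtain ⟨R, hR⟩ := ih hQ'
    exact ⟨R, by rw [hQ, hR, pow_succ]; ring⟩

/-! ### Small values of `λ` are attained high in the cusp -/

/-- **Every small `x ≠ 0` is a value `λ(τ)` with `Im τ` as large as we please** (the nome map
`q ↦ λ/16` is open at `q = 0`, `ModularLambdaNome.lean`). [folklore] -/
theorem exists_forall_exists_modularLambda_eq (B : ℝ) :
    ∃ r : ℝ, 0 < r ∧ ∀ x : ℂ, x ≠ 0 → ‖x‖ < r → ∃ τ : ℂ, B ≤ τ.im ∧ modularLambda τ = x := by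
  set Λ := cuspFunction 2 (fun τ : ℍ ↦ modularLambda τ / 16) with hΛ
  have han : AnalyticAt ℂ Λ 0 :=
    differentiableOn_cuspFunction_modularLambda.analyticAt (ball_mem_nhds 0 one_pos)
  -- `Λ` is not locally constant at `0` (`Λ'(0) = 1`)
  have hnc : ¬ ∀ᶠ z in 𝓝 (0 : ℂ), Λ z = Λ 0 := by
    intro hc
    have h1 : deriv Λ 0 = deriv (fun _ : ℂ ↦ Λ 0) 0 := Filter.EventuallyEq.deriv_eq hc
    rw [deriv_const, hΛ, deriv_cuspFunction_modularLambda_zero] at h1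
    exact one_ne_zero h1
  have hmap : 𝓝 (Λ 0) ≤ map Λ (𝓝 0) :=
    (han.eventually_constant_or_nhds_le_map_nhds).resolve_left hnc
  -- nomes of modulus `< δ` come from `Im τ > B`
  set δ : ℝ := min (Real.exp (-(π * B))) 1 with hδ
  have hδ0 : 0 < δ := lt_min (Real.exp_pos _) one_pos
  have himage : Λ '' ball 0 δ ∈ 𝓝 (0 : ℂ) := by
    rw [hΛ, cuspFunction_modularLambda_zero, ← hΛ] at hmap
    exact hmap (image_mem_map (ball_mem_nhds 0 hδ0))
  obtain ⟨r₀, hr₀, hsub⟩ := Metric.mem_nhds_iff.mp himage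
  refine ⟨16 * r₀, by positivity, fun x hx hxr ↦ ?_⟩
  have hx16 : x / 16 ∈ ball (0 : ℂ) r₀ := by
    rw [mem_ball, dist_zero_right, norm_div]
    have : ‖(16 : ℂ)‖ = 16 := by simp
    rw [this, div_lt_iff₀ (by norm_num : (0 : ℝ) < 16)]
    linarith
  obtain ⟨q, hq, hqx⟩ := hsub hx16
  rw [mem_ball, dist_zero_right] at hq
  have hq1 : ‖q‖ < 1 := lt_of_lt_of_le hq (min_le_right _ _)
  have hq0 : q ≠ 0 := by
    rintro rfl
    rw [hΛ, cuspFunction_modularLambda_zero] at hqx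
    exact hx (by linear_combination (-16) * hqx)
  obtain ⟨τ, hτ, hqτ, hΛq⟩ := exists_cuspFunction_modularLambda_eq hq1 hq0
  refine ⟨τ, ?_, ?_⟩
  · -- `‖q‖ = e^{-π Im τ} < e^{-π B}`
    have hnq : ‖q‖ = Real.exp (-(π * τ.im)) := by
      rw [← hqτ, Complex.norm_exp]
      congr 1
      simp [Complex.mul_re, Complex.mul_im]
    have hlt : Real.exp (-(π * τ.im)) < Real.exp (-(π * B)) :=
      hnq ▸ lt_of_lt_of_le hq (min_le_left _ _)
    rw [Real.exp_lt_exp] at hlt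
    nlinarith [Real.pi_pos]
  · rw [← hΛ] at hΛq
    rw [hΛq] at hqx
    linear_combination 16 * hqx

/-! ### `f/Uᵏ` is bounded at the cusps `∞` and `0` -/

/-- `|U(z)| ≥ 1/2` high up (`U → 1`). [folklore] -/
theorem exists_forall_half_le_norm_thetaU :
    ∃ B : ℝ, ∀ z : ℍ, B ≤ z.im → 1 / 2 ≤ ‖thetaU z‖ := by
  obtain ⟨B, hB⟩ :=
    (atImInfty_mem _).mp (tendsto_thetaU (Metric.ball_mem_nhds (1 : ℂ) one_half_pos))
  refine ⟨B, fun z hz ↦ ?_⟩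
  have h : dist (thetaU z) 1 < 1 / 2 := hB z hz
  rw [dist_eq_norm] at h
  have h1 : (1 : ℝ) - ‖thetaU z‖ ≤ ‖thetaU z - 1‖ := by
    have := norm_sub_norm_le (1 : ℂ) (thetaU z)
    rwa [norm_one, norm_sub_rev] at this
  linarith

/-- **`f/Uᵏ` is bounded at the cusp `∞`** for `f ∈ M_{2k}(Γ)`. [folklore] -/
theorem exists_norm_modularForm_div_le {Γ : Subgroup SL(2, ℤ)} [Γ.FiniteIndex] (k : ℕ)
    (f : ModularForm (Γ : Subgroup (GL (Fin 2) ℝ)) (2 * k : ℤ)) :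
    ∃ B M : ℝ, ∀ z : ℍ, B ≤ z.im → ‖f z / theta3 z ^ (4 * k)‖ ≤ M := by
  obtain ⟨M, A, hMA⟩ := isBoundedAtImInfty_iff.mp (ModularFormClass.bdd_at_infty f)
  obtain ⟨B, hB⟩ := exists_forall_half_le_norm_thetaU
  refine ⟨max A B, max M 0 * 2 ^ k, fun z hz ↦ ?_⟩
  have hf : ‖f z‖ ≤ max M 0 := (hMA z ((le_max_left _ _).trans hz)).trans (le_max_left _ _)
  have hU : 1 / 2 ≤ ‖thetaU z‖ := hB z ((le_max_right _ _).trans hz)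
  have hUpos : 0 < ‖thetaU z‖ := lt_of_lt_of_le one_half_pos hU
  rw [pow_mul, ← thetaU_apply, norm_div, norm_pow, div_le_iff₀ (pow_pos hUpos k)]
  calc ‖f z‖ ≤ max M 0 := hf
    _ = max M 0 * 2 ^ k * (1 / 2) ^ k := by rw [mul_assoc, ← mul_pow]; norm_num
    _ ≤ max M 0 * 2 ^ k * ‖thetaU z‖ ^ k := by gcongr

/-- **`f/Uᵏ` is bounded at the cusp `0`**: `|(f/Uᵏ)(−1/z)| ≤ M` high up (`U|₂S = −U`).
[folklore] -/
theorem exists_norm_modularForm_div_S_smul_le {Γ : Subgroup SL(2, ℤ)} [Γ.FiniteIndex] (k : ℕ)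
    (f : ModularForm (Γ : Subgroup (GL (Fin 2) ℝ)) (2 * k : ℤ)) :
    ∃ B M : ℝ, ∀ z : ℍ, B ≤ z.im →
      ‖f (ModularGroup.S • z) / theta3 ((ModularGroup.S • z : ℍ) : ℂ) ^ (4 * k)‖ ≤ M := by
  obtain ⟨M, A, hMA⟩ :=
    isBoundedAtImInfty_iff.mp (ModularFormClass.bdd_at_infty_slash f ModularGroup.S)
  obtain ⟨B, hB⟩ := exists_forall_half_le_norm_thetaU
  refine ⟨max A B, max M 0 * 2 ^ k, fun z hz ↦ ?_⟩
  have hf : ‖(⇑f ∣[(2 * k : ℤ)] ModularGroup.S) z‖ ≤ max M 0 :=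
    (hMA z ((le_max_left _ _).trans hz)).trans (le_max_left _ _)
  have hU : 1 / 2 ≤ ‖thetaU z‖ := hB z ((le_max_right _ _).trans hz)
  have hUpos : 0 < ‖thetaU z‖ := lt_of_lt_of_le one_half_pos hU
  rw [modularForm_div_smul_eq_slash, thetaU_slash_S, Pi.neg_apply, neg_pow, norm_div, norm_mul,
    norm_pow, norm_neg, norm_one, one_pow, one_mul, norm_pow, div_le_iff₀ (pow_pos hUpos k)]
  calc ‖(⇑f ∣[(2 * k : ℤ)] ModularGroup.S) z‖ ≤ max M 0 := hf
    _ = max M 0 * 2 ^ k * (1 / 2) ^ k := by rw [mul_assoc, ← mul_pow]; norm_num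
    _ ≤ max M 0 * 2 ^ k * ‖thetaU z‖ ^ k := by gcongr

/-! ### The structure theorem -/

/-- **`f/θ₃^{4k} = Q(λ)` with `deg Q ≤ k`** for `f ∈ M_{2k}(Γ(2))`: in
`(f/Uᵏ) λᵏ(1−λ)ᵏ = P(λ)` (`exists_polynomial_modularForm_Gamma_two`) the polynomial `P` is divisible
by `Xᵏ` (boundedness of `f/Uᵏ` at the cusp `∞`, `λ → 0`) and by `(1−X)ᵏ` (boundedness at the
cusp `0`, `λ(−1/τ) = 1 − λ(τ) → 1`). [cite: CohnEtAl2019, §2.1.2] -/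
theorem exists_polynomial_modularForm_Gamma_two_eq_eval (k : ℕ)
    (f : ModularForm ((CongruenceSubgroup.Gamma 2 : Subgroup SL(2, ℤ)) : Subgroup (GL (Fin 2) ℝ))
      (2 * k : ℤ)) :
    ∃ Q : ℂ[X], Q.natDegree ≤ k ∧ ∀ τ : ℍ, f τ / theta3 τ ^ (4 * k) = Q.eval (modularLambda τ) := by
  obtain ⟨P, hPdeg, hP⟩ := exists_polynomial_modularForm_Gamma_two k f
  -- bounds at the two cusps
  obtain ⟨B₁, M₁, hM₁⟩ := exists_norm_modularForm_div_le k f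
  obtain ⟨B₂, M₂, hM₂⟩ := exists_norm_modularForm_div_S_smul_le k f
  obtain ⟨r, hr, hsurj⟩ := exists_forall_exists_modularLambda_eq (max (max B₁ B₂) 1)
  have hτ_of : ∀ τ : ℂ, max (max B₁ B₂) 1 ≤ τ.im → 0 < τ.im := fun τ hτ ↦
    lt_of_lt_of_le one_pos ((le_max_right _ _).trans hτ)
  -- `X^k ∣ P`
  have hX : X ^ k ∣ P := by
    refine X_pow_dvd_of_norm_eval_le (C := max M₁ 0 * 2 ^ k) (lt_min hr one_pos) fun x hx hxr ↦ ?_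
    obtain ⟨τ, hτB, rfl⟩ := hsurj x hx (lt_of_lt_of_le hxr (min_le_left _ _))
    have hτ0 := hτ_of τ hτB
    have hPτ := hP ⟨τ, hτ0⟩
    rw [← hPτ, norm_mul, norm_mul, norm_pow, norm_pow]
    have hF : ‖f ⟨τ, hτ0⟩ / theta3 τ ^ (4 * k)‖ ≤ max M₁ 0 :=
      (hM₁ ⟨τ, hτ0⟩ ((le_max_left _ _).trans ((le_max_left _ _).trans hτB))).trans
        (le_max_left _ _)
    have h1x : ‖1 - modularLambda τ‖ ≤ 2 := by
      have : ‖modularLambda τ‖ < 1 := lt_of_lt_of_le hxr (min_le_right _ _)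
      calc ‖1 - modularLambda τ‖ ≤ ‖(1 : ℂ)‖ + ‖modularLambda τ‖ := norm_sub_le _ _
        _ ≤ 2 := by rw [norm_one]; linarith
    calc ‖f ⟨τ, hτ0⟩ / theta3 τ ^ (4 * k)‖ * (‖modularLambda τ‖ ^ k * ‖1 - modularLambda τ‖ ^ k)
        ≤ max M₁ 0 * (‖modularLambda τ‖ ^ k * 2 ^ k) := by gcongr
      _ = max M₁ 0 * 2 ^ k * ‖modularLambda τ‖ ^ k := by ring
  -- `(1 - X)^k ∣ P`, through `P.comp (1 - X)`
  have h1X : (1 - X) ^ k ∣ P := by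
    have hcomp : X ^ k ∣ P.comp (1 - X) := by
      refine X_pow_dvd_of_norm_eval_le (C := max M₂ 0 * 2 ^ k) (lt_min hr one_pos)
        fun x hx hxr ↦ ?_
      obtain ⟨τ, hτB, rfl⟩ := hsurj x hx (lt_of_lt_of_le hxr (min_le_left _ _))
      have hτ0 := hτ_of τ hτB
      -- `P(1 - λ τ) = P(λ(S τ)) = F(S τ) λ(Sτ)^k (1 - λ(Sτ))^k`
      have hPS := hP (ModularGroup.S • ⟨τ, hτ0⟩)
      rw [modularLambda_S_smul, UpperHalfPlane.coe_mk, sub_sub_cancel] at hPS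
      rw [eval_comp, eval_sub, eval_one, eval_X, ← hPS, norm_mul, norm_mul, norm_pow, norm_pow]
      have hF : ‖f (ModularGroup.S • ⟨τ, hτ0⟩) /
          theta3 ((ModularGroup.S • (⟨τ, hτ0⟩ : ℍ) : ℍ) : ℂ) ^ (4 * k)‖ ≤ max M₂ 0 :=
        (hM₂ ⟨τ, hτ0⟩ ((le_max_right _ _).trans ((le_max_left _ _).trans hτB))).trans
          (le_max_left _ _)
      have h1x : ‖1 - modularLambda τ‖ ≤ 2 := by
        have : ‖modularLambda τ‖ < 1 := lt_of_lt_of_le hxr (min_le_right _ _)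
        calc ‖1 - modularLambda τ‖ ≤ ‖(1 : ℂ)‖ + ‖modularLambda τ‖ := norm_sub_le _ _
          _ ≤ 2 := by rw [norm_one]; linarith
      calc ‖f (ModularGroup.S • ⟨τ, hτ0⟩) /
            theta3 ((ModularGroup.S • (⟨τ, hτ0⟩ : ℍ) : ℍ) : ℂ) ^ (4 * k)‖ *
            (‖1 - modularLambda τ‖ ^ k * ‖modularLambda τ‖ ^ k)
          ≤ max M₂ 0 * (2 ^ k * ‖modularLambda τ‖ ^ k) := by gcongr
        _ = max M₂ 0 * 2 ^ k * ‖modularLambda τ‖ ^ k := by ring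
    obtain ⟨R, hR⟩ := hcomp
    have hcc : (P.comp (1 - X)).comp (1 - X) = P := by
      rw [Polynomial.comp_assoc, sub_comp, one_comp, X_comp, sub_sub_cancel, comp_X]
    refine ⟨R.comp (1 - X), ?_⟩
    rw [← hcc, hR, mul_comp, pow_comp, X_comp]
  -- `P = X^k (1-X)^k Q`
  have hcop : IsCoprime (X ^ k : ℂ[X]) ((1 - X) ^ k) :=
    (show IsCoprime (X : ℂ[X]) (1 - X) from ⟨1, 1, by ring⟩).pow
  obtain ⟨Q, hQ⟩ := hcop.mul_dvd hX h1X
  have hlam : ∀ τ : ℍ, modularLambda (τ : ℂ) ^ k * (1 - modularLambda τ) ^ k ≠ 0 := fun τ ↦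
    mul_ne_zero (pow_ne_zero _ (modularLambda_ne_zero τ.im_pos))
      (pow_ne_zero _ (sub_ne_zero.mpr (modularLambda_ne_one τ.im_pos).symm))
  have hFQ : ∀ τ : ℍ, f τ / theta3 τ ^ (4 * k) = Q.eval (modularLambda τ) := by
    intro τ
    have := hP τ
    rw [hQ, eval_mul, eval_mul, eval_pow, eval_pow, eval_sub, eval_one, eval_X, mul_comm] at this
    exact mul_left_cancel₀ (hlam τ) this
  refine ⟨Q, ?_, hFQ⟩
  -- the degree of `Q`
  by_cases hQ0 : Q = 0
  · rw [hQ0, natDegree_zero]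
    exact Nat.zero_le _
  have hM0 : (X ^ k * (1 - X) ^ k : ℂ[X]) ≠ 0 :=
    mul_ne_zero (pow_ne_zero _ X_ne_zero) (pow_ne_zero _ (by
      rw [sub_ne_zero]; exact fun h1 ↦ by simpa using congrArg (Polynomial.eval 0) h1))
  have hdegM : (X ^ k * (1 - X) ^ k : ℂ[X]).natDegree = 2 * k := by
    have h1 : ((1 : ℂ[X]) - X).natDegree = 1 := by
      rw [show (1 : ℂ[X]) - X = -(X - C 1) by rw [map_one]; ring, natDegree_neg, natDegree_X_sub_C]
    rw [natDegree_mul (pow_ne_zero _ X_ne_zero) (pow_ne_zero _ (by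
      intro h0; rw [h0, natDegree_zero] at h1; exact zero_ne_one h1)),
      natDegree_pow, natDegree_X, natDegree_pow, h1]
    ring
  have hdegP : P.natDegree = 2 * k + Q.natDegree := by rw [hQ, natDegree_mul hM0 hQ0, hdegM]
  omega

/-- **Every `f ∈ M_{2k}(Γ(2))` is a homogeneous polynomial of degree `k` in `U = θ₃⁴` and
`V = θ₂⁴`**: `f = Σ_{j ≤ k} q_j θ₂^{4j} θ₃^{4(k−j)}` on `ℍ` ("`𝓜(Γ(2))` is the polynomial ring
generated by `V` and `W`", `U = V + W`). [cite: CohnEtAl2019, §2.1.2] -/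
theorem exists_eq_sum_theta_pow_mul_theta_pow (k : ℕ)
    (f : ModularForm ((CongruenceSubgroup.Gamma 2 : Subgroup SL(2, ℤ)) : Subgroup (GL (Fin 2) ℝ))
      (2 * k : ℤ)) :
    ∃ c : ℕ → ℂ, ∀ τ : ℍ, f τ =
      ∑ j ∈ Finset.range (k + 1), c j * theta2 τ ^ (4 * j) * theta3 τ ^ (4 * (k - j)) := by
  obtain ⟨Q, hQdeg, hQ⟩ := exists_polynomial_modularForm_Gamma_two_eq_eval k f
  refine ⟨fun j ↦ Q.coeff j, fun τ ↦ ?_⟩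
  have hθ : theta3 (τ : ℂ) ^ (4 * k) ≠ 0 := pow_ne_zero _ (theta3_ne_zero τ.im_pos)
  have hθ3 : theta3 (τ : ℂ) ≠ 0 := theta3_ne_zero τ.im_pos
  have hf : f τ = Q.eval (modularLambda τ) * theta3 τ ^ (4 * k) := by
    rw [← hQ τ, div_mul_cancel₀ _ hθ]
  rw [hf, eval_eq_sum_range' (Nat.lt_succ_of_le hQdeg), Finset.sum_mul]
  refine Finset.sum_congr rfl fun j hj ↦ ?_
  have hjk : j ≤ k := Nat.lt_succ_iff.mp (Finset.mem_range.mp hj)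
  rw [modularLambda_def, div_pow, ← pow_mul, ← pow_mul,
    show theta3 (τ : ℂ) ^ (4 * k) = theta3 τ ^ (4 * j) * theta3 τ ^ (4 * (k - j)) by
      rw [← pow_add, ← mul_add, Nat.add_sub_cancel' hjk]]
  field_simp

/-- **`dim M_{2k}(Γ(2)) ≤ k + 1`.** (`f ↦ Q`, the polynomial of
`exists_polynomial_modularForm_Gamma_two_eq_eval`, is an injective linear map into the polynomials
of degree `≤ k`.) [cite: CohnEtAl2019, §2.1.2] -/
theorem finrank_modularForm_Gamma_two_le (k : ℕ) :
    Module.finrank ℂ (ModularForm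
      ((CongruenceSubgroup.Gamma 2 : Subgroup SL(2, ℤ)) : Subgroup (GL (Fin 2) ℝ)) (2 * k : ℤ)) ≤
      k + 1 := by
  classical
  set Γ2 : Subgroup (GL (Fin 2) ℝ) :=
    ((CongruenceSubgroup.Gamma 2 : Subgroup SL(2, ℤ)) : Subgroup (GL (Fin 2) ℝ)) with hΓ2
  have key := exists_polynomial_modularForm_Gamma_two_eq_eval k
  set Qf : ModularForm Γ2 (2 * k : ℤ) → ℂ[X] := fun f ↦ Classical.choose (key f) with hQf
  have hQf_deg : ∀ f, (Qf f).natDegree ≤ k := fun f ↦ (Classical.choose_spec (key f)).1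
  have hQf_eval : ∀ f (τ : ℍ), f τ / theta3 τ ^ (4 * k) = (Qf f).eval (modularLambda τ) :=
    fun f ↦ (Classical.choose_spec (key f)).2
  have hadd : ∀ f g, Qf (f + g) = Qf f + Qf g := fun f g ↦
    polynomial_eq_of_eval_modularLambda_eq fun τ ↦ by
      rw [eval_add, ← hQf_eval, ← hQf_eval, ← hQf_eval, ModularForm.add_apply, add_div]
  have hsmul : ∀ (c : ℂ) f, Qf (c • f) = c • Qf f := fun c f ↦
    polynomial_eq_of_eval_modularLambda_eq fun τ ↦ by
      rw [eval_smul, ← hQf_eval, ← hQf_eval, smul_eq_mul, show (c • f) τ = c * f τ from rfl,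
        mul_div_assoc]
  let L : ModularForm Γ2 (2 * k : ℤ) →ₗ[ℂ] ℂ[X] :=
    { toFun := Qf, map_add' := hadd, map_smul' := hsmul }
  have hLinj : Function.Injective L := by
    intro f g hfg
    have h' : Qf f = Qf g := hfg
    refine ModularForm.ext fun τ ↦ ?_
    have e1 := hQf_eval f τ
    rw [h', ← hQf_eval g τ] at e1
    have hθ : theta3 (τ : ℂ) ^ (4 * k) ≠ 0 := pow_ne_zero _ (theta3_ne_zero τ.im_pos)
    exact (div_left_inj' hθ).mp e1
  have hrange : ∀ f, L f ∈ Polynomial.degreeLT ℂ (k + 1) := fun f ↦ by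
    rw [Polynomial.mem_degreeLT]
    exact Polynomial.degree_le_natDegree.trans_lt (by exact_mod_cast Nat.lt_succ_of_le (hQf_deg f))
  set L' := LinearMap.codRestrict (Polynomial.degreeLT ℂ (k + 1)) L hrange with hL'
  have hL'inj : Function.Injective L' := fun f g h ↦ hLinj (by
    have := congrArg Subtype.val h
    simpa only [hL', LinearMap.codRestrict_apply] using this)
  haveI : FiniteDimensional ℂ (Polynomial.degreeLT ℂ (k + 1)) :=
    LinearEquiv.finiteDimensional (Polynomial.degreeLTEquiv ℂ (k + 1)).symm
  calc Module.finrank ℂ (ModularForm Γ2 (2 * k : ℤ))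
      ≤ Module.finrank ℂ (Polynomial.degreeLT ℂ (k + 1)) :=
        LinearMap.finrank_le_finrank_of_injective hL'inj
    _ = k + 1 := by
        rw [(Polynomial.degreeLTEquiv ℂ (k + 1)).finrank_eq, Module.finrank_fin_fun]

/-! ### The monomials `Vʲ U^{k−j}` are modular forms for `Γ(2)`; `dim M_{2k}(Γ(2)) = k + 1` -/

/-- Powers under the weight-`k` slash action: `(fⁿ)|_{nk} A = (f|_k A)ⁿ`. [folklore] -/
theorem pow_slash (f : ℍ → ℂ) (k : ℤ) (A : SL(2, ℤ)) (n : ℕ) :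
    (f ^ n) ∣[(n : ℤ) * k] A = (f ∣[k] A) ^ n := by
  induction n with
  | zero =>
    rw [pow_zero, pow_zero, Nat.cast_zero, zero_mul]
    exact ModularForm.is_invariant_one A
  | succ n ih =>
    rw [pow_succ, pow_succ, show ((n + 1 : ℕ) : ℤ) * k = (n : ℤ) * k + k by push_cast; ring,
      ModularForm.mul_slash_SL2, ih]

/-- Powers of functions bounded at `i∞` are bounded at `i∞`. [folklore] -/
theorem isBoundedAtImInfty_pow {f : ℍ → ℂ} (hf : IsBoundedAtImInfty f) (n : ℕ) :
    IsBoundedAtImInfty (f ^ n) := by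
  induction n with
  | zero =>
    rw [pow_zero]
    exact Filter.const_boundedAtFilter _ _
  | succ n ih =>
    rw [pow_succ]
    exact ih.mul hf

/-- Each of `±U, ±V, ±W` is bounded at `i∞` (`U, W → 1`, `V → 0`). [folklore] -/
theorem isBoundedAtImInfty_of_mem_six {X : ℍ → ℂ}
    (hX : X ∈ ({thetaU, -thetaU, thetaV, -thetaV, thetaW, -thetaW} : Set (ℍ → ℂ))) :
    IsBoundedAtImInfty X := by
  simp only [Set.mem_insert_iff, Set.mem_singleton_iff] at hX
  have hU : IsBoundedAtImInfty thetaU := tendsto_thetaU.isBigO_one ℝ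
  have hV : IsBoundedAtImInfty thetaV := ModularForms.tendsto_thetaV.isBigO_one ℝ
  have hW : IsBoundedAtImInfty thetaW := ModularForms.tendsto_thetaW.isBigO_one ℝ
  rcases hX with rfl | rfl | rfl | rfl | rfl | rfl
  exacts [hU, hU.neg_left, hV, hV.neg_left, hW, hW.neg_left]

/-- **`V = θ₂⁴` is a modular form of weight `2` for `Γ(2)`**: `V|₂γ = V` for `γ ∈ Γ(2)`.
[cite: CohnEtAl2019, §2.1.2] -/
theorem thetaV_slash_eq_of_mem_Gamma_two {γ : SL(2, ℤ)} (hγ : γ ∈ CongruenceSubgroup.Gamma 2) :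
    thetaV ∣[(2 : ℤ)] γ = thetaV := by
  refine GammaTwo.forall_mem_Gamma_two_slash_eq (f := thetaV) (k := 2) ?_ ?_ ?_ γ hγ
  · show thetaV ∣[(2 : ℤ)] (ModularGroup.T ^ 2) = thetaV
    rw [pow_two, SlashAction.slash_mul, thetaV_slash_T, SlashAction.neg_slash, thetaV_slash_T,
      neg_neg]
  · show thetaV ∣[(2 : ℤ)] (ModularGroup.S * ModularGroup.T ^ 2 * ModularGroup.S⁻¹) = thetaV
    rw [SlashAction.slash_mul, SlashAction.slash_mul, thetaV_slash_S, SlashAction.neg_slash,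
      pow_two, SlashAction.slash_mul, thetaW_slash_T, thetaU_slash_T, SlashAction.neg_slash,
      thetaW_slash_S_inv, neg_neg]
  · show thetaV ∣[(2 : ℤ)] (-1 : SL(2, ℤ)) = thetaV
    rw [← S_mul_S, SlashAction.slash_mul, thetaV_slash_S, SlashAction.neg_slash, thetaW_slash_S,
      neg_neg]

/-- The weight-`2k` slash action on the monomial `Vʲ U^{k−j}`, `j ≤ k`:
`(Vʲ U^{k−j})|_{2k} g = (V|₂g)ʲ (U|₂g)^{k−j}`. [folklore] -/
theorem monomial_slash {k j : ℕ} (hjk : j ≤ k) (g : SL(2, ℤ)) :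
    (thetaV ^ j * thetaU ^ (k - j)) ∣[(2 * k : ℤ)] g =
      (thetaV ∣[(2 : ℤ)] g) ^ j * (thetaU ∣[(2 : ℤ)] g) ^ (k - j) := by
  have hw : (2 * k : ℤ) = (j : ℤ) * 2 + ((k - j : ℕ) : ℤ) * 2 := by
    push_cast [Nat.cast_sub hjk]
    ring
  rw [hw, ModularForm.mul_slash_SL2, pow_slash, pow_slash]

/-- **The monomials `Vʲ U^{k−j}` (`j ≤ k`) are modular forms of weight `2k` for `Γ(2)`**, and
**`dim M_{2k}(Γ(2)) = k + 1`**: they are linearly independent (`λ = V/U` takes infinitely many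
values) and `M_{2k}(Γ(2))` has dimension `≤ k + 1` (`finrank_modularForm_Gamma_two_le`). With
`U = V + W` this is the degree-`k` part of "`𝓜(Γ(2))` is the polynomial ring generated by `V`
and `W`". [cite: CohnEtAl2019, §2.1.2] -/
theorem finrank_modularForm_Gamma_two (k : ℕ) :
    Module.finrank ℂ (ModularForm
      ((CongruenceSubgroup.Gamma 2 : Subgroup SL(2, ℤ)) : Subgroup (GL (Fin 2) ℝ)) (2 * k : ℤ)) =
      k + 1 := by
  classical
  set Γ2 : Subgroup (GL (Fin 2) ℝ) :=
    ((CongruenceSubgroup.Gamma 2 : Subgroup SL(2, ℤ)) : Subgroup (GL (Fin 2) ℝ)) with hΓ2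
  refine le_antisymm (finrank_modularForm_Gamma_two_le k) ?_
  have hVsix : thetaV ∈ ({thetaU, -thetaU, thetaV, -thetaV, thetaW, -thetaW} : Set (ℍ → ℂ)) := by
    simp
  have hUsix : thetaU ∈ ({thetaU, -thetaU, thetaV, -thetaV, thetaW, -thetaW} : Set (ℍ → ℂ)) := by
    simp
  -- the monomials as modular forms
  let φ : Fin (k + 1) → ModularForm Γ2 (2 * k : ℤ) := fun j ↦
    { toFun := thetaV ^ (j : ℕ) * thetaU ^ (k - j)
      slash_action_eq' := fun A hA ↦ by
        obtain ⟨γ, hγ, rfl⟩ := hA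
        show (thetaV ^ (j : ℕ) * thetaU ^ (k - j)) ∣[(2 * k : ℤ)] γ =
          thetaV ^ (j : ℕ) * thetaU ^ (k - j)
        rw [monomial_slash (Nat.lt_succ_iff.mp j.isLt), thetaV_slash_eq_of_mem_Gamma_two hγ,
          thetaU_slash_of_mem_Gamma_two hγ]
      holo' := (ModularForms.mdifferentiable_thetaV.pow _).mul
        (ModularForms.mdifferentiable_thetaU.pow _)
      bdd_at_cusps' := fun hc ↦ by
        rw [Subgroup.IsArithmetic.isCusp_iff_isCusp_SL2Z] at hc
        rw [OnePoint.isBoundedAt_iff_forall_SL2Z hc]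
        intro γ _
        rw [monomial_slash (Nat.lt_succ_iff.mp j.isLt)]
        exact (isBoundedAtImInfty_pow (isBoundedAtImInfty_of_mem_six (slash_mem_six γ _ hVsix))
          _).mul (isBoundedAtImInfty_pow (isBoundedAtImInfty_of_mem_six
            (slash_mem_six γ _ hUsix)) _) }
  have hφ : ∀ (j : Fin (k + 1)) (τ : ℍ), φ j τ = thetaV τ ^ (j : ℕ) * thetaU τ ^ (k - j) :=
    fun j τ ↦ rfl
  -- linear independence
  have hsum : ∀ (g : Fin (k + 1) → ℂ) (s : Finset (Fin (k + 1))) (τ : ℍ),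
      (∑ i ∈ s, g i • φ i) τ = ∑ i ∈ s, g i * φ i τ := by
    intro g s τ
    induction s using Finset.induction_on with
    | empty => simp
    | insert a s ha ih =>
      rw [Finset.sum_insert ha, Finset.sum_insert ha, ModularForm.add_apply, ih]
      rfl
  have hind : LinearIndependent ℂ φ := by
    rw [Fintype.linearIndependent_iff]
    intro g hg
    -- the polynomial `Σ g_j X^j` vanishes at every `λ(τ)`
    set P : ℂ[X] := ∑ j : Fin (k + 1), Polynomial.C (g j) * Polynomial.X ^ (j : ℕ) with hP
    have hP0 : P = 0 := by
      refine polynomial_eq_of_eval_modularLambda_eq (q := 0) fun τ ↦ ?_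
      have h := congrArg (fun F : ModularForm Γ2 (2 * k : ℤ) ↦ F τ) hg
      simp only [hsum] at h
      rw [show (0 : ModularForm Γ2 (2 * k : ℤ)) τ = 0 from rfl] at h
      have hU0 : thetaU τ ≠ 0 := ModularForms.thetaU_ne_zero τ
      rw [eval_zero, hP, eval_finsetSum]
      have hdiv := congrArg (· / thetaU τ ^ k) h
      simp only [zero_div, Finset.sum_div] at hdiv
      rw [← hdiv]
      refine Finset.sum_congr rfl fun j _ ↦ ?_
      have hjk : (j : ℕ) ≤ k := Nat.lt_succ_iff.mp j.isLt
      rw [eval_mul, eval_C, eval_pow, eval_X, hφ, modularLambda_def, ← thetaV_apply, ← thetaU_apply,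
        div_pow, show thetaU τ ^ k = thetaU τ ^ (j : ℕ) * thetaU τ ^ (k - j) by
          rw [← pow_add, Nat.add_sub_cancel' hjk]]
      field_simp
    intro i
    have := congrArg (fun Q : ℂ[X] ↦ Q.coeff i) hP0
    simp only [hP, finsetSum_coeff, coeff_C_mul_X_pow, coeff_zero] at this
    rw [Finset.sum_eq_single i (fun j _ hji ↦ if_neg (fun h ↦ hji (Fin.ext h.symm))) (by simp)]
      at this
    simpa using this
  haveI := (finiteDimensional_modularForm_Gamma_two k).1
  simpa using hind.fintype_card_le_finrank

end ModularLambda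

end Literature.NumberTheory.Automorphic

end
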